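import Summits.CriticalPhenomena.PercolationContinuityZ3.Theorems.PercAnnulusCrossingIICTwoRoots
import Summits.CriticalPhenomena.PercolationContinuityZ3.Theorems.PercAnnulusCrossingIICTwoPointLower
import Summits.CriticalPhenomena.PercolationContinuityZ3.Theorems.PercAnnulusCrossingIICTwoPointUpper
import HarnessLib

/-!
# The pair-arm probability: `P(0 ↔ ∂Λ(n), x ↔ ∂Λ(n)) ∼ ν(0 ↔ x)·π(n)` (lane RSW3, p1 gen 18)

builds on p205010 (kernel theorem, internal audit signed; external expert review pending) — used only in the `p_c` corollaries (`θ(p_c) = 0`).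

RSW3 lane (LANE 3 `prim-rsw3`), seat `prim-rsw3-p1` (gen 18).  Helper file (`--supports stmt-CriticalPhenomena-4575`);
no definitions, no sorries.  Memo `run/shared/lean/prim/rsw3/P1-QM.md` §31.

`A_n = {0 ↔ ∂ⁱⁿΛ(n) in Λ(n)}`, `B_n(x) = {x ↔ ∂ⁱⁿΛ(n) in Λ(n)}`.  The two-root ratio limit of `…IICTwoRoots` at `F = univ` reads:

* **`tendsto_real_two_arms_div_oneArmProb`** — under (A2)□ at aspect `(s,L)` and `θ(p) = 0` (`d ≥ 1`, `p > 0`): **`P_p(A_n ∩ B_n(x)) / π_p(n) → ν(0 ↔ x)`**,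
  i.e. **`P_p(x ↔ ∂ⁱⁿΛ(n) | 0 ↔ ∂ⁱⁿΛ(n)) → ν(0 ↔ x)`** (`tendsto_cond_arm_at`): the conditional probability that a neighbouring site ALSO has a long
  arm is, in the limit, the IIC two-point function — the pair-arm probability from two nearby sites is `ν(0 ↔ x)·π(n)(1 + o(1))`;
* **`eventually_two_arms_le_and_ge_criticalProbI`** — at `p_c(ℤ^d)`, `d ≥ 2`, under (A2)□(s,L) + `CU⁺_l` + UAD: for `‖x‖_∞ = m ≥ n₀`, eventually in `n`,
  **`(c/2)·π_{p_c}(m)·π_{p_c}(n) ≤ P(A_n ∩ B_n(x)) ≤ 2C·π_{p_c}(⌊(m−1)/2⌋)·π_{p_c}(n)`** — PAIR-ARM QUASI-MULTIPLICATIVITY from gen 18's two-point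
  lower bound and gen 7's upper bound.
References: H. Kesten, PTRF 73 (1986) Thm. (3), (8); D. Basu, A. Sapozhnikov, ECP 22 (2017).
-/

noncomputable section

namespace Summit.CriticalPhenomena.PercolationContinuityZ3.Theorems.Crossing

open MeasureTheory Filter Topology Literature.Probability.Percolation Literature.Probability.LatticeModels
open Literature.Probability.Percolation.DCT16
open Summit.CriticalPhenomena.PercolationContinuityZ3.Theorems.SurfaceTension
open scoped Literature.Probability.Percolation

variable {d : ℕ}

/-- **THE PAIR-ARM PROBABILITY `P(A_n ∩ B_n(x)) / π(n) → ν(0 ↔ x)`** (under (A2)□ at aspect `(s,L)`, `θ(p) = 0`, `d ≥ 1`, `p > 0`; `ν` any IIC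
probability measure): `…IICTwoRoots`' ratio limit at `F = univ`. [cite: Kesten1986, Thm. (3)] [cite: BasuSapozhnikov2017ECP, Thm. 1.1] -/
theorem tendsto_real_two_arms_div_oneArmProb (hd : 1 ≤ d) (p : unitInterval) (hp : 0 < (p : ℝ))
    (hθ : theta (zdGraph d) 0 p = 0) {s L : ℕ} (hs : 1 ≤ s) {ϰ : ℝ} (hϰ : 0 < ϰ) (hA2 : SetToSetQuasiMultAspectAt d p s L ϰ)
    {ν : Measure (BondConfig (Site d))} [IsProbabilityMeasure ν]
    (hν : ∀ (F : Finset (Sym2 (Site d))) (E : Set (BondConfig (Site d))), MeasurableSet E → DeterminedBy E ↑F →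
      Tendsto (fun n : ℕ => (bondPercolation (zdGraph d) p).real (E ∩ siteToBoundary d n) / oneArmProb d p n)
        atTop (𝓝 (ν.real E))) (x : Site d) :
    Tendsto (fun n : ℕ => (bondPercolation (zdGraph d) p).real (siteToBoundary d n ∩ {ω : BondConfig (Site d) |
        ∃ t ∈ innerBoundary (zdGraph d) (box d n), ω ∈ openConnIn (↑(box d n) : Set (Site d)) x t}) / oneArmProb d p n)
      atTop (𝓝 (ν.real (openConn 0 x))) := by
  have h := tendsto_real_inter_two_arms_div_oneArmProb hd p hp hθ hs hϰ hA2 hν x (F := Set.univ) ⟨∅, fun _ _ _ => by simp⟩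
  simpa only [Set.univ_inter] using h

/-- **`P_p(x ↔ ∂ⁱⁿΛ(n) | 0 ↔ ∂ⁱⁿΛ(n)) → ν(0 ↔ x)`**: given that the origin has a long arm, the conditional probability that the site `x` also
has one converges to the IIC two-point function (same hypotheses). [cite: Kesten1986, Thm. (3)] -/
theorem tendsto_cond_arm_at (hd : 1 ≤ d) (p : unitInterval) (hp : 0 < (p : ℝ))
    (hθ : theta (zdGraph d) 0 p = 0) {s L : ℕ} (hs : 1 ≤ s) {ϰ : ℝ} (hϰ : 0 < ϰ) (hA2 : SetToSetQuasiMultAspectAt d p s L ϰ)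
    {ν : Measure (BondConfig (Site d))} [IsProbabilityMeasure ν]
    (hν : ∀ (F : Finset (Sym2 (Site d))) (E : Set (BondConfig (Site d))), MeasurableSet E → DeterminedBy E ↑F →
      Tendsto (fun n : ℕ => (bondPercolation (zdGraph d) p).real (E ∩ siteToBoundary d n) / oneArmProb d p n)
        atTop (𝓝 (ν.real E))) (x : Site d) :
    Tendsto (fun n : ℕ => (bondPercolation (zdGraph d) p).real ({ω : BondConfig (Site d) |
        ∃ t ∈ innerBoundary (zdGraph d) (box d n), ω ∈ openConnIn (↑(box d n) : Set (Site d)) x t} ∩ siteToBoundary d n) /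
        (bondPercolation (zdGraph d) p).real (siteToBoundary d n))
      atTop (𝓝 (ν.real (openConn 0 x))) := by
  refine (tendsto_real_two_arms_div_oneArmProb hd p hp hθ hs hϰ hA2 hν x).congr fun n => ?_
  rw [Set.inter_comm]
  rfl

/-- **PAIR-ARM QUASI-MULTIPLICATIVITY AT `p_c(ℤ^d)`** (`d ≥ 2`; (A2)□ at `(s,L)`, `2 ≤ s ≤ L`, `ϰ > 0`; `CU⁺_l(c_U)`, `l ≥ 2`, `c_U > 0`; UAD): there
are `n₀` and `0 < c, C` such that for every `x` with `‖x‖_∞ = m`, `max 7 n₀ ≤ m`, EVENTUALLY IN `n`: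
**`(c/2)·π_{p_c}(m)·π_{p_c}(n) ≤ P_{p_c}(0 ↔ ∂ⁱⁿΛ(n), x ↔ ∂ⁱⁿΛ(n)) ≤ 2C·π_{p_c}(⌊(m−1)/2⌋)·π_{p_c}(n)`** — the pair-arm limit `ν(0↔x)π(n)` with gen 18's
two-point lower bound and gen 7's upper bound; existence of `ν` from (A2)□ (p1 gen 4). [cite: Kesten1986, Thm. (8)] [cite: BasuSapozhnikov2017ECP, Thm. 1.1] -/
theorem eventually_two_arms_le_and_ge_criticalProbI (hd : 2 ≤ d) {s L : ℕ} (hs : 2 ≤ s) (hsL : s ≤ L) {ϰ : ℝ} (hϰ : 0 < ϰ)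
    (hA2 : SetToSetQuasiMultAspectAt d (criticalProbI d) s L ϰ) {l : ℕ} (hl : 2 ≤ l) {cU : ℝ} (hcU : 0 < cU)
    (hCU : ∀ a : ℕ, 1 ≤ a → ∀ E : Set (BondConfig (Site d)), IsUpperSet E → MeasurableSet E →
      cU * (bondPercolation (zdGraph d) (criticalProbI d)).real E ≤ (bondPercolation (zdGraph d) (criticalProbI d)).real (E ∩
        {ω : BondConfig (Site d) | ∀ t ∈ innerBoundary (zdGraph d) (box d a), ∀ s ∈ innerBoundary (zdGraph d) (box d (l * a)),
          ∀ t' ∈ innerBoundary (zdGraph d) (box d a), ∀ s' ∈ innerBoundary (zdGraph d) (box d (l * a)),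
          ω ∈ openConnIn (↑((box d (l * a) \ box d a) ∪ innerBoundary (zdGraph d) (box d a)) : Set (Site d)) t s →
          ω ∈ openConnIn (↑((box d (l * a) \ box d a) ∪ innerBoundary (zdGraph d) (box d a)) : Set (Site d)) t' s' →
          ω ∈ openConnIn (↑((box d (l * a) \ box d a) ∪ innerBoundary (zdGraph d) (box d a)) : Set (Site d)) s s'}))
    (hUAD : ∀ ε : ℝ, 0 < ε → ∃ K₀ : ℕ, ∀ m : ℕ, 1 ≤ m → ∀ N : ℕ, K₀ * m ≤ N →
      (bondPercolation (zdGraph d) (criticalProbI d)).real (boxCrossing d m N) ≤ ε) :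
    ∃ (n₀ : ℕ) (c C : ℝ), 0 < c ∧ 0 < C ∧ ∀ (m : ℕ) (x : Site d), max 7 n₀ ≤ m → x ∈ sphere d m →
      ∀ᶠ n : ℕ in atTop,
        c / 2 * oneArmProb d (criticalProbI d) m * oneArmProb d (criticalProbI d) n ≤
          (bondPercolation (zdGraph d) (criticalProbI d)).real (siteToBoundary d n ∩ {ω : BondConfig (Site d) |
            ∃ t ∈ innerBoundary (zdGraph d) (box d n), ω ∈ openConnIn (↑(box d n) : Set (Site d)) x t}) ∧
        (bondPercolation (zdGraph d) (criticalProbI d)).real (siteToBoundary d n ∩ {ω : BondConfig (Site d) |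
            ∃ t ∈ innerBoundary (zdGraph d) (box d n), ω ∈ openConnIn (↑(box d n) : Set (Site d)) x t}) ≤
          2 * C * oneArmProb d (criticalProbI d) ((m - 1) / 2) * oneArmProb d (criticalProbI d) n := by
  have hd1 : 1 ≤ d := le_trans (by norm_num) hd
  have hp : 0 < ((criticalProbI d : unitInterval) : ℝ) := by
    rw [coe_criticalProbI]; exact criticalProb_zd_pos d hd1
  have hπ : ∀ n, 0 < oneArmProb d (criticalProbI d) n := oneArmProb_pos hd1 _ hp
  obtain ⟨n₀, c, hn₀, hc, hlow⟩ := exists_le_iicMeasure_real_openConn_criticalProbI hd hs hsL hϰ hA2 hl hcU hCU hUAD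
  obtain ⟨C, hC, hup⟩ := iicMeasure_real_openConn_le_criticalProbI hd hs hsL hϰ hA2
  -- an IIC measure exists under (A2)□
  obtain ⟨ν, hνprob, hν⟩ := exists_iicMeasure_of_kestenIICExistsAt hd1 (criticalProbI d) hp
    (kestenIICExistsAt_criticalProbI_of_setToSetQuasiMultAspectAt hd hs hϰ hA2)
  refine ⟨n₀, c, C, hc, hC, fun m x hm hx => ?_⟩
  have hm7 : 7 ≤ m := le_trans (le_max_left _ _) hm
  have hmn₀ : n₀ ≤ m := le_trans (le_max_right _ _) hm
  have hlo : c * oneArmProb d (criticalProbI d) m ≤ ν.real (openConn 0 x) := hlow ν hν m x hmn₀ hx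
  have hhi : ν.real (openConn 0 x) ≤ C * oneArmProb d (criticalProbI d) ((m - 1) / 2) := hup ν hν m x hm7 hx
  have hνpos : 0 < ν.real (openConn 0 x) := iicMeasure_real_openConn_pos hd1 _ hp hν x
  have hT := tendsto_real_two_arms_div_oneArmProb hd1 _ hp (CSH.percolationContinuity_allDimensions d hd) (by omega) hϰ hA2 hν x
  have h1 := (tendsto_order.1 hT).1 (ν.real (openConn 0 x) / 2) (by linarith)
  have h2 := (tendsto_order.1 hT).2 (2 * ν.real (openConn 0 x)) (by linarith)
  filter_upwards [h1, h2] with n hn1 hn2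
  rw [lt_div_iff₀ (hπ n)] at hn1
  rw [div_lt_iff₀ (hπ n)] at hn2
  constructor
  · calc c / 2 * oneArmProb d (criticalProbI d) m * oneArmProb d (criticalProbI d) n
        = (c * oneArmProb d (criticalProbI d) m) / 2 * oneArmProb d (criticalProbI d) n := by ring
      _ ≤ ν.real (openConn 0 x) / 2 * oneArmProb d (criticalProbI d) n :=
          mul_le_mul_of_nonneg_right (by linarith) (hπ n).le
      _ ≤ _ := hn1.le
  · calc (bondPercolation (zdGraph d) (criticalProbI d)).real (siteToBoundary d n ∩ {ω : BondConfig (Site d) |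
            ∃ t ∈ innerBoundary (zdGraph d) (box d n), ω ∈ openConnIn (↑(box d n) : Set (Site d)) x t})
        ≤ 2 * ν.real (openConn 0 x) * oneArmProb d (criticalProbI d) n := hn2.le
      _ ≤ 2 * (C * oneArmProb d (criticalProbI d) ((m - 1) / 2)) * oneArmProb d (criticalProbI d) n :=
          mul_le_mul_of_nonneg_right (by linarith) (hπ n).le
      _ = _ := by ring

end Summit.CriticalPhenomena.PercolationContinuityZ3.Theorems.Crossing

end
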